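import Mathlib.RingTheory.AlgebraicIndependent.Defs
import Mathlib.RingTheory.Localization.Defs
import Mathlib.RingTheory.Etale.Basic
import Mathlib.RingTheory.Smooth.Basic
import Mathlib.RingTheory.Ideal.Quotient.Operations
import Mathlib.Algebra.MvPolynomial.CommRing
import Mathlib.Data.Finset.Option
import HarnessLib

/-!
# Hu 2025 (arXiv:2507.21400v1), §6.3 «Properties of ℘-blowups and ℓ-blowup in the block (𝔊_k)» —
# Def. 6.10, Prop. 6.11 (with eqs. (6.8), (6.9)), Def. 6.12, Prop. 6.15, Def. 6.17: statements-first typing,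
# file a = `S06WpEllBlowups/R108aWpEllChart.lean` of lit/PARTITION-HU.md row 108 (file b = `R108bProp611Items.lean`:
# Prop. 6.11 (1)–(9), Def. 6.12, Prop. 6.15, Def. 6.17; file c = `R108cEquationsWpEll.lean`: Prop. 6.18, Cor. 6.19) —
# typed for lit/PARTITION-HU.md row 108 by res-type-081 (typer of record; M-Hu-min re-pointing line 2026-08-27T08:00:07Z) from
# res-type-029's FILING-READY SPLIT v2 pre-draft (2026-08-27T04:4xZ) with res-type-081's T9 locator audit
# (HOME/plan/tools/res-type-081/hu/T9-AUDIT-row108.md); every locator below was re-read on the TeX chunks of record.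

**STATUS OF THE SOURCE (D-0012 / D-0089): UNREFEREED PREPRINT UNDER ADJUDICATION.** Y. Hu, *Universal
Characteristic-free Resolution of Singularities, I*, arXiv:2507.21400v1 (2025-07-29, 162 pp.) [Hu2025]; held as
`paper:arxiv-2507.21400` = the arXiv TeX source in 73 chunks; LOCATOR OF RECORD = chunk + line `C<cc>L<l>`
(lit/PARTITION-HU.md §0), next to it the arXiv PDF page «p.N» (renders lit/res-lit-6/hu25/hu25_p106/p107/p108/p120.png
were viewed for the PDF item numbering). Statements below are `def … : Prop` CANDIDATES tagged
`[claim: Hu2025, status: under-review]` — «STATUS: candidate statement under adjudication (D-0012/D-0089); not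
asserted»; nothing is proved, nothing is asserted, no declaration takes a side. AI typing, weaker than expert review.

## Carrier level (PARTITION-HU §1 «CARRIER LEVEL»; extends interface I-CH of row 106)
Prop. 6.11 is a statement about ONE admissible affine chart `𝔙` of `ℛ̃_{(℘_(kτ) 𝔯_μ 𝔰_h)}` (C47L48–L53). Unlike the
standard charts of `ℛ̃_{ϑ[k]}` (row 106: affine spaces `R[Var_𝔙]`, I-CH `ChartStep`/`ChartSeq`), an admissible chart
here is a SHRUNK affine open («By shrinking the admissible affine chart 𝔙 if necessary», C47L64; «we may shrink 𝔙 …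
(for example, making y_{𝔙,(m,u_F)} invertible)», C48L125–L127), and the text CLAIMS — does not presuppose — that
`Var_𝔙` (eq. (6.8), C47L104–L118) and `Var^∨_𝔙` (eq. (6.9), C47L137–L141) are «sets of free variables on the open
chart 𝔙» (proof sentences C50L123–L124 and C50L135–L137 = JOINT J4 / G-H11 of PARTITION-HU §4). So the chart is typed
as an ABSTRACT commutative `R`-algebra `A` (its coordinate ring) carrying
* LABEL data (C47L75–L81): `eps ⊂ 𝕀⋆_{3,n}` (= `𝔢_𝔙`), `del ⊂ Λ⋆_𝔉` (= `𝔡_𝔙`), `ell ⊂ 𝔉` (= `𝔩_𝔙`, the `F` with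
  `L_F ∈ 𝔩_𝔙`), and `𝔡^lt_𝔙 = {(m,u_F) | L_F ∈ 𝔩_𝔙}` through the map `ltIdx : F ↦ (m,u_F)` (row 105 I-GOV's leading
  ϱ-index; PDF Def. 4.48);
* NAMED ELEMENTS of `A`: one element per index `w ∈ 𝕀⋆_{3,n}` (`ε_{𝔙,w}` if `w ∈ 𝔢_𝔙`, else `x_{𝔙,w}`), one per
  `(u,v) ∈ Λ⋆_𝔉` (`δ_{𝔙,(u,v)}` if `(u,v) ∈ 𝔡_𝔙 ∖ 𝔡^lt_𝔙`, `y_{𝔙,(m,u_F)}` if `(u,v) = (m,u_F) ∈ 𝔡^lt_𝔙`, else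
  `x_{𝔙,(u,v)}`) — this is `Var_𝔙` of (6.8), `|Var_𝔙| = |𝕀⋆_{3,n}| + |Λ⋆_𝔉|` at every stage — and one EXTRA element
  `δ_{𝔙,(m,u_F)} ∈ Var_{𝔩_𝔙}` per `L_F ∈ 𝔩_𝔙` (C47L120–L124; footnote 6 p.108 = C47L127–L133: «only elements (m,u_F)
  in 𝔡^lt_𝔙 may index two variables δ_{𝔙,(m,u_F)} and y_{𝔙,(m,u_F)}»);
* DIVISOR data as ideals of `A` (the chart-restrictions of the divisors the nine properties speak about): the
  ϖ-divisors `X_{(℘ r s),w}` (`w ∈ 𝕀⋆`), the ϱ-divisors `X_{(℘ r s),(u,v)}` (`(u,v) ∈ Λ⋆`), the exceptional divisors of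
  `ℛ̃_{℘_(kτ)}` («i.e., not a ϖ- nor a ϱ-divisor nor a 𝔏-divisor», C47L83–L85) indexed by an abstract type `ιE` with
  their LABEL map (C47L83–L95), the proper transforms `L_{𝔙,F}` of the `L_F` (Prop. 6.11 (9), Prop. 6.15), and the
  ideal of `𝒱̃_{(℘ r s)} ∩ 𝔙` (Def. 6.10); an ideal `= ⊤` renders «does not intersect the chart».
The index types `ι₁` (= `𝕀⋆_{3,n} = 𝕀_{3,n} ∖ {m}`, C47L58), `ι₂` (= `Λ⋆_𝔉 = Λ_𝔉 ∖ Λ^o_𝔉`, C47L58), `ιF` (= `𝔉`, the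
blocks `F_j`, `j ∈ [Υ]`) and the base ring `R` (Hu: «the base field 𝕜», C34L15–L16; `𝔽 = ℚ or 𝔽_p` only in §8, C67L4)
are parameters: rows 101/102/105 (I-PL, I-ORD, I-GOV) instantiate them. «Set of free variables on the open chart» is
NOT defined in print for a shrunk chart (§3 C18L83–L88 says, for `𝐔_Gr`, «canonically isomorphic to the affine space
with the above variables as its local free variables»); it is typed as a PARAMETRIC reading `IsFreeVariables` with
three named instantiations OURS (`IsFreeVariablesLoc` = open immersion into the affine space, `IsFreeVariablesEtale`
= étale coordinates, `IsFreeVariablesIndep` = algebraic independence; Loc ⇒ Étale-part and Loc ⇒ Indep are kernel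
facts not stated here) — the adjudication of J4 reads `Prop6_11_varVee` at the reading it names.

## Items ↦ declarations (FQ prefix `Literature.AlgebraicGeometry.Hu2025.Statements.S06WpEllBlowups.`)
* Def. 6.10 C47L13–L20; p.106 ↦ `IsAdmissible` (+ alias `Def6_10`).
* Prop. 6.11 frame C47L36–L59; p.106–107 ↦ parameters of `WpEllChart` (docstring); C47L61–L68 (◇ smoothness) ↦
  `Prop6_11_smooth`, `Prop6_11_centreSmooth`; C47L70–L97 (◇ labels) ↦ `WpEllChart` fields `eps/del/ell`, `deltaLt`
  (= `Prop6_11_dV`), `ellSet` (= `Prop6_11_lV`), `Prop6_11_labels`; C47L99–L133 eq. (6.8) (◇ variables) ↦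
  `WpEllChart.var`, `WpEllChart.varEll`, `Prop6_11_var` (+ `C50L123`), `Prop6_11_yUnit`; C47L135–L141 eq. (6.9) ↦
  `WpEllChart.varVee`, `Prop6_11_varVee` (+ `C50L135`) = JOINT J4; C47L143–L148 ↦ `WpEllChart.varPlus`,
  `Prop6_11_relPoly` (`C47L147`); (◇) nine properties C48L1–L30 = PDF p.108 items (1)–(8) ↦ `Prop6_11_1` … `Prop6_11_8`;
  (◇e) C48L32 ↦ `Prop6_11_e`; item (9) C48L34–L55; p.108–109 ↦ `Prop6_11_9a`, `Prop6_11_9b` (+ `Prop6_11_9`).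
* Def. 6.12 C51L141–L146; p.116 ↦ `IsPreferred` (+ `Def6_12`); C51L148–L150 ↦ `C51L148` (covering claim, slot).
* Prop. 6.15 C52L31–L33; p.117 ↦ `Prop6_15`.
* Def. 6.17 C53L20–L33; p.119 ↦ `TerminatesAt₆`, `TerminatesOnChart`, `Def6_17` (the «on ℛ̃» clause = ∀ over a family
  of admissible charts, `Def6_17_all`).
Out of scope here (row 108 file b, owner): eq. (6.7) `Ω` and the induction frame (row 107 carriers ℘-sets, 𝔯_μ𝔰_h);
Cor. 6.13 / Rem. 6.14 (scheme-level isomorphism `Ṽ_{ℓ_k} → Ṽ_{℘_k}`; row 110 vocabulary); Prop. 6.16 [OPT, «not used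
anywhere in the current article», C52L71–L73]; Prop. 6.18 (1)(1a)(1b)(2)(2a)(2b)(3)(4) and Cor. 6.19 (need I-R/I-GOV's
`ℬ^gov`, `ℬ^frb`, term degrees, the order `B > B_(kτ)`, `ρ_(kτ)`; reading hazard: PDF p.120 l.4 «as in (6.11)» cites
EQUATION (6.11) = display C49L27–L30, not Proposition 6.11).

## Rendering choices (for the owner / lanes; each is a choice, none takes a side)
* One element of `A` per index of `𝕀⋆ ⊔ Λ⋆` (fields `var₁`, `var₂`): which NAME (ε/δ/y/x) it carries is decided by
  the label sets, exactly as printed in (6.8); the extra ℓ-exceptional `δ_{𝔙,(m,u_F)}` (field `deltaEll`, indexed by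
  `(m,u_F) ∈ 𝔡^lt_𝔙 ⊂ Λ⋆`) is the ONLY symbol not in `Var_𝔙` (footnote 6).
* Prop. 6.11 (6) «for all (u,v) ∈ 𝔡_𝔙 … (δ_{𝔙,(u,v)} = 0)» is typed with the printed symbol resolution
  `WpEllChart.delta`: for `(u,v) ∈ 𝔡_𝔙 ∖ 𝔡^lt_𝔙` the `Var_𝔙`-element, for `(u,v) = (m,u_F) ∈ 𝔡^lt_𝔙` the
  ℓ-exceptional element of `Var_{𝔩_𝔙}` (C50L60–L63 define `δ_{𝔙,(m,u_{F_k})} := y'_i`, the equation of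
  `D_{℘_k,L_{F_k}} ∩ 𝔙'`; proof of (9) C51L67–L81, display L79: `E_{ℓ_k} ∩ 𝔙 = (L⋆_{𝔙',F_k} = 0)`). So at `(m,u_F) ∈ 𝔡^lt_𝔙`
  items (6) and (7) name the same function; typed AS PRINTED, flagged here, no `_ours` sibling (the owner decides).
* «does not intersect the chart» ↦ the divisor's chart ideal is `⊤`; «E ∩ 𝔙 is defined by (v = 0)» ↦ the chart ideal
  `= Ideal.span {v}`; «smooth» (chart / centre / divisor) ↦ Mathlib `Algebra.Smooth R _` of the corresponding
  coordinate ring resp. quotient, unfolded as `IsSmoothAlg` = formally smooth ∧ finite presentation (equivalent to the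
  class by `Algebra.smooth_iff`; Hu works over a field; for the lanes: this is smoothness over the base, the printed
  word).
* (9) «Suppose 𝔙 lies over the chart (x_{(m,u_{F_j})} ≡ 1) of ℛ» / «over the ϱ-standard chart of ℛ̃_{ϑ[j]}» are
  POSITION predicates of the chart word (row 106 `ChartSeq`, Def. 5.13–5.15): parameters `liesOverPl`, `liesOverRhoStd`.
* Sic on these chunks (recorded, no mathematical content): C47L23 «give a blowup morphsim»; C47L99 «Various free
  variables of on the chart»; C47L126 «be prove accordingly»; C48L14/L19/L24 «is define by»; PDF «Lemmminglea» headers.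
-/

noncomputable section

open MvPolynomial

namespace Literature.AlgebraicGeometry.Hu2025.Statements.S06WpEllBlowups

universe u v w u₁ u₂ u₃ u₄

variable (R : Type u) [CommRing R]

/-! ## «smooth» and «set of free variables on the open chart» — OURS vocabulary -/

/-- **«smooth» for the coordinate ring of a chart / a divisor / a centre (Prop. 6.11 (◇), (◇e); Prop. 6.15): formally
smooth of finite presentation over the base** — the two fields of Mathlib's class `Algebra.Smooth R A` written as a
conjunction (equivalent to it by `Algebra.smooth_iff`), so that the statements below stay ordinary `Prop`s and the lanes
read the two components of the printed word directly. OURS vocabulary (standard).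
[claim: Hu2025, status: under-review]
STATUS: candidate statement under adjudication (D-0012/D-0089); not asserted. -/
def IsSmoothAlg (A : Type w) [CommRing A] [Algebra R A] : Prop :=
  Algebra.FormallySmooth R A ∧ Algebra.FinitePresentation R A

/-! ## «Set of free variables on the open chart» — parametric reading + three named instantiations (OURS) -/

/-- **Reading (OURS vocabulary) of «a set of free variables on the (open) chart» — LOCALIZATION / OPEN-IMMERSION
form.** §3 C18L83–L88 (p.38–39): «the chart 𝐔_Gr = 𝐔 ∩ Gr^{3,E} comes equipped with the set of free variables Var_𝐔 …
and is canonically isomorphic to the affine space with the above variables as its local free variables»; Prop. 6.11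
proof C50L123–L124 «one sees that Var_𝔙 is a set of free variables on the open chart 𝔙». Typed: the coordinate ring
`A` of the chart is a localization of the polynomial ring `R[σ]` through the evaluation map `X_i ↦ v i` (the chart is
an affine open piece of the affine space with coordinates `v`). One of three typed readings; the text does not define
the phrase for a shrunk chart.
[claim: Hu2025, status: under-review]
STATUS: candidate statement under adjudication (D-0012/D-0089); not asserted. -/
def IsFreeVariablesLoc {σ : Type v} {A : Type w} [CommRing A] [Algebra R A] (v : σ → A) : Prop :=
  ∃ M : Submonoid (MvPolynomial σ R),
    @IsLocalization (MvPolynomial σ R) _ M A _ (MvPolynomial.aeval v).toRingHom.toAlgebra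

/-- **Reading (OURS vocabulary) — ÉTALE-COORDINATES form** («a regular system of coordinates of the smooth chart»,
lit/PARTITION-HU.md §4 J4): `A` is étale over `R[σ]` through `X_i ↦ v i`.
[claim: Hu2025, status: under-review]
STATUS: candidate statement under adjudication (D-0012/D-0089); not asserted. -/
def IsFreeVariablesEtale {σ : Type v} {A : Type w} [CommRing A] [Algebra R A] (v : σ → A) : Prop :=
  @Algebra.Etale (MvPolynomial σ R) A _ _ (MvPolynomial.aeval v).toRingHom.toAlgebra

/-- **Reading (OURS vocabulary) — ALGEBRAIC-INDEPENDENCE form** (the weakest: no polynomial relation among the listed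
functions; Mathlib `AlgebraicIndependent`).
[claim: Hu2025, status: under-review]
STATUS: candidate statement under adjudication (D-0012/D-0089); not asserted. -/
def IsFreeVariablesIndep {σ : Type v} {A : Type w} [CommRing A] [Algebra R A] (v : σ → A) : Prop :=
  AlgebraicIndependent R v

/-! ## The admissible chart `𝔙` of `ℛ̃_{(℘_(kτ) 𝔯_μ 𝔰_h)}` with its labels, variables and divisors (Prop. 6.11) -/

/-- **The data an admissible affine chart `𝔙` of `ℛ̃_{(℘_(kτ) 𝔯_μ 𝔰_h)}` «comes equipped with» (Prop. 6.11,
C47L48–L59 frame, C47L70–L148; p.106–108), at carrier level.** `A` = the coordinate ring of the (shrunk, C47L64)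
chart. Frame C47L48–L55: «Fix and consider any admissible affine chart 𝔙 of ℛ̃_{(℘_(kτ)𝔯_μ𝔰_h)}, lying over a unique
admissible affine chart 𝔙' of ℛ̃_{(℘_(kτ)𝔯_μ𝔰_{h−1})}, and both lying over a unique affine chart 𝔙_[0] of ℛ … indexed
by Λ^o_𝔉 = {(v_{s_{F,o}}, v_{s_{F,o}}) ∣ F̄ ∈ 𝔉}. We set 𝕀⋆_{3,n} = 𝕀_{3,n} ∖ m, Λ⋆_𝔉 = Λ_𝔉 ∖ Λ^o_𝔉, and
L_{𝔉,[k]} = {L_{F_j} ∣ j ∈ [k]}» — `ι₁ := 𝕀⋆_{3,n}`, `ι₂ := Λ⋆_𝔉`, `ιF := 𝔉` (its elements `F`, with `L_F`), and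
`ltIdx F := (m, u_F) ∈ Λ⋆_𝔉` (leading ϱ-index of the block, PDF Def. 4.48 = chunk ‹4.47› C31L162; row 105).
C47L72–L81: «The smooth admissible affine chart 𝔙 … comes equipped with a subset 𝔢_𝔙 ⊂ 𝕀⋆_{3,n}, a subset
𝔡_𝔙 ⊂ Λ⋆_𝔉, and a subset 𝔩_𝔙 ⊂ L_{𝔉,[k]} and also the subset 𝔡^lt_𝔙 = {(m, u_F) ∣ L_F ∈ 𝔩_𝔙} ⊂ 𝔡_𝔙».
Eq. (6.8) C47L104–L118: «Var_𝔙 := {ε_{𝔙,w}, δ_{𝔙,(u,v)} ∣ w ∈ 𝔢_𝔙, (u,v) ∈ 𝔡_𝔙 ∖ 𝔡^lt_𝔙; y_{𝔙,(m,u_F)} ∣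
(m,u_F) ∈ 𝔡^lt_𝔙; x_{𝔙,w}, x_{𝔙,(u,v)} ∣ w ∈ 𝕀⋆_{3,n} ∖ 𝔢_𝔙, (u,v) ∈ Λ⋆_𝔉 ∖ 𝔡_𝔙}» (ONE variable per index of
`𝕀⋆ ⊔ Λ⋆`: fields `var₁`, `var₂`); C47L120–L124 «Var_{𝔩_𝔙} = {δ_{𝔙,(m,u_F)} ∣ L_F ∈ 𝔩_𝔙}» (field `deltaEll`).
Divisor data (ideals of `A`, `⊤` = «does not intersect the chart»): `plDiv w` = `X_{(℘ r s),w} ∩ 𝔙`, `rhoDiv (u,v)` =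
`X_{(℘ r s),(u,v)} ∩ 𝔙` (PDF Def. 4.53 = chunk Def. 4.52 C32L54–L73 and their proper transforms), `excDiv E` for `E`
ranging over the exceptional divisors of `ℛ̃_{℘_(kτ)}` («i.e., not a ϖ- nor a ϱ-divisor nor a 𝔏-divisor», C47L83–L85;
index type `ιE`) with the label map `lab` (C47L86–L95), `ellForm F` = `L_{𝔙,F}` («the proper transform of L_F»,
Prop. 5.11 / C48L48), `vIdeal` = the ideal of `𝒱̃_{(℘ r s)} ∩ 𝔙` (Def. 6.10). EXISTENCE of such data along the
induction is the CONTENT of Prop. 6.11 (typed below as Props over this record); the record itself asserts nothing.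
[claim: Hu2025, status: under-review]
STATUS: candidate statement under adjudication (D-0012/D-0089); not asserted. -/
structure WpEllChart (ι₁ : Type u₁) (ι₂ : Type u₂) (ιF : Type u₃) (ιE : Type u₄) (A : Type w) [CommRing A] where
  /-- `𝔢_𝔙 ⊂ 𝕀⋆_{3,n}` (C47L75) — indices whose variable is a ϖ-exceptional `ε_{𝔙,w}` -/
  eps : Finset ι₁
  /-- `𝔡_𝔙 ⊂ Λ⋆_𝔉` (C47L76) — indices whose variable is ϱ-exceptional `δ_{𝔙,(u,v)}` (or `y_{𝔙,(m,u_F)}` on `𝔡^lt_𝔙`) -/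
  del : Finset ι₂
  /-- `𝔩_𝔙 ⊂ L_{𝔉,[k]}` recorded by the set of `F` with `L_F ∈ 𝔩_𝔙` (C47L77) -/
  ell : Finset ιF
  /-- `F ↦ (m, u_F)`, the index of the leading ϱ-variable of the block `𝔊_F` (C47L81 «(m, u_F)»; row 105 / row 106
  `ThetaFrame.lead : … → Option Rs`): `none` when `(m,u_F) ∈ Λ^o_𝔉` is the chart index of `𝔙_[0]` (then `L_F ∉ 𝔩_𝔙`,
  Prop. 6.11 (9) first clause), `some (m,u_F)` with `(m,u_F) ∈ Λ⋆_𝔉` otherwise -/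
  ltIdx : ιF → Option ι₂
  /-- the variable of `Var_𝔙` attached to `w ∈ 𝕀⋆_{3,n}`: `ε_{𝔙,w}` for `w ∈ 𝔢_𝔙`, `x_{𝔙,w}` otherwise (eq. (6.8)) -/
  var₁ : ι₁ → A
  /-- the variable of `Var_𝔙` attached to `(u,v) ∈ Λ⋆_𝔉`: `δ_{𝔙,(u,v)}` on `𝔡_𝔙 ∖ 𝔡^lt_𝔙`, `y_{𝔙,(m,u_F)}` on
  `𝔡^lt_𝔙`, `x_{𝔙,(u,v)}` otherwise (eq. (6.8)) -/
  var₂ : ι₂ → A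
  /-- the ℓ-exceptional variable `δ_{𝔙,(m,u_F)} ∈ Var_{𝔩_𝔙}` for `(m,u_F) ∈ 𝔡^lt_𝔙` (C47L120–L124; values off
  `𝔡^lt_𝔙` are unused) -/
  deltaEll : ι₂ → A
  /-- chart ideal of the ϖ-divisor `X_{(℘_(kτ)𝔯_μ𝔰_h),w}`, `w ∈ 𝕀⋆_{3,n}` (items (1), (3)) -/
  plDiv : ι₁ → Ideal A
  /-- chart ideal of the ϱ-divisor `X_{(℘_(kτ)𝔯_μ𝔰_h),(u,v)}`, `(u,v) ∈ Λ⋆_𝔉` (items (2), (4)) -/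
  rhoDiv : ι₂ → Ideal A
  /-- chart ideal of the exceptional divisor `E` of `ℛ̃_{℘_(kτ)}` («not a ϖ- nor a ϱ-divisor nor a 𝔏-divisor»,
  C47L83–L85), `E : ιE`; `⊤` iff `E ∩ 𝔙 = ∅` (items (5)–(8)) -/
  excDiv : ιE → Ideal A
  /-- the LABEL of an exceptional divisor meeting the chart (C47L86–L89): `w ∈ 𝔢_𝔙` (ϖ-exceptional, `E_{ℓ_k,w}`),
  `(u,v) ∈ 𝔡_𝔙` (ϱ-exceptional, `E_{ℓ_k,(u,v)}`) or `L_F ∈ 𝔩_𝔙` (𝔩-exceptional, `E_{ℓ_k,L_F}`); `none` for the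
  divisors not meeting the chart (item (8)) -/
  lab : ιE → Option (ι₁ ⊕ ι₂ ⊕ ιF)
  /-- `L_{𝔙,F}`, the proper transform on `𝔙` of the linearized Plücker form `L_F` (item (9), Prop. 6.15;
  C47L147 «L_{𝔙,F} ∣ F ∈ 𝔉») -/
  ellForm : ιF → A
  /-- the ideal of `𝒱̃_{(℘_(kτ)𝔯_μ𝔰_h)} ∩ 𝔙` in the chart (Def. 6.10; Prop. 6.18) -/
  vIdeal : Ideal A

namespace WpEllChart

variable {R}
variable {ι₁ : Type u₁} {ι₂ : Type u₂} {ιF : Type u₃} {ιE : Type u₄} {A : Type w} [CommRing A] [DecidableEq ι₂]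
variable (C : WpEllChart ι₁ ι₂ ιF ιE A)

/-- **`𝔡^lt_𝔙 = {(m, u_F) ∣ L_F ∈ 𝔩_𝔙}` (C47L81; p.107) — the carrier `Prop6_11_dV` of PARTITION-HU row 108.**
[claim: Hu2025, status: under-review]
STATUS: candidate statement under adjudication (D-0012/D-0089); not asserted. -/
def deltaLt : Finset ι₂ := Finset.eraseNone (C.ell.image C.ltIdx)

/-- **`𝔩_𝔙 ⊂ L_{𝔉,[k]}` as the set of blocks `F` with `L_F ∈ 𝔩_𝔙` (C47L77; p.107) — the carrier `Prop6_11_lV` of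
PARTITION-HU row 108.**
[claim: Hu2025, status: under-review]
STATUS: candidate statement under adjudication (D-0012/D-0089); not asserted. -/
def ellSet : Finset ιF := C.ell

/-- **`Var_𝔙` of eq. (6.8) (C47L104–L118; p.107) as a family indexed by `𝕀⋆_{3,n} ⊔ Λ⋆_𝔉`.** «Further, the chart 𝔙
admits a set of free variables Var_𝔙 := {ε_{𝔙,w}, δ_{𝔙,(u,v)} ∣ w ∈ 𝔢_𝔙, (u,v) ∈ 𝔡_𝔙 ∖ 𝔡^lt_𝔙; y_{𝔙,(m,u_F)} ∣
(m,u_F) ∈ 𝔡^lt_𝔙; x_{𝔙,w}, x_{𝔙,(u,v)} ∣ w ∈ 𝕀⋆_{3,n} ∖ 𝔢_𝔙, (u,v) ∈ Λ⋆_𝔉 ∖ 𝔡_𝔙}.»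
[claim: Hu2025, status: under-review]
STATUS: candidate statement under adjudication (D-0012/D-0089); not asserted. -/
def var : ι₁ ⊕ ι₂ → A := Sum.elim C.var₁ C.var₂

/-- **`Var_{𝔩_𝔙} = {δ_{𝔙,(m,u_F)} ∣ L_F ∈ 𝔩_𝔙, i.e., (m,u_F) ∈ 𝔡^lt_𝔙}` (C47L120–L124; p.108), «a set of
exceptional variables for ℓ-exceptional divisors», as a family on the subtype `𝔡^lt_𝔙`.**
[claim: Hu2025, status: under-review]
STATUS: candidate statement under adjudication (D-0012/D-0089); not asserted. -/
def varEll : C.deltaLt → A := fun uv => C.deltaEll uv.1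

/-- **The symbol `δ_{𝔙,(u,v)}` for `(u,v) ∈ 𝔡_𝔙` as items (6)/(7) use it (printed symbol resolution, module docstring
«Rendering choices»):** the `Var_𝔙`-variable `δ_{𝔙,(u,v)}` for `(u,v) ∈ 𝔡_𝔙 ∖ 𝔡^lt_𝔙`, the ℓ-exceptional
`δ_{𝔙,(m,u_F)} ∈ Var_{𝔩_𝔙}` for `(u,v) = (m,u_F) ∈ 𝔡^lt_𝔙` (C50L53–L63; footnote 6 p.108 = C47L127–L133).
[claim: Hu2025, status: under-review]
STATUS: candidate statement under adjudication (D-0012/D-0089); not asserted. -/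
def delta (uv : ι₂) : A := if uv ∈ C.deltaLt then C.deltaEll uv else C.var₂ uv

/-- **`Var^∨_𝔙` of eq. (6.9) (C47L135–L141; p.108) as a family indexed by `𝕀⋆_{3,n} ⊔ Λ⋆_𝔉`.** «Furthermore, we also
have a set of free variables Var^∨_𝔙 = ({y ∈ Var_𝔙} ∖ {y_{(m,u_F)} ∣ L_F ∈ 𝔩_𝔙}) ⊔ {δ_{𝔙,(m,u_F)} ∣ L_F ∈ 𝔩_𝔙}.»
Typed: `Var_𝔙` with, at every index `(m,u_F) ∈ 𝔡^lt_𝔙`, the variable `y_{𝔙,(m,u_F)}` REPLACED by the ℓ-exceptional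
`δ_{𝔙,(m,u_F)}` (same index set). The CLAIM that this is a set of free variables is `Prop6_11_varVee` (JOINT J4).
[claim: Hu2025, status: under-review]
STATUS: candidate statement under adjudication (D-0012/D-0089); not asserted. -/
def varVee : ι₁ ⊕ ι₂ → A := Sum.elim C.var₁ C.delta

/-- **`Var^+_𝔙 = Var_𝔙 ⊔ Var_{𝔩_𝔙}` (C47L143–L145; p.108) as a family indexed by `(𝕀⋆_{3,n} ⊔ Λ⋆_𝔉) ⊔ 𝔡^lt_𝔙`.**
[claim: Hu2025, status: under-review]
STATUS: candidate statement under adjudication (D-0012/D-0089); not asserted. -/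
def varPlus : (ι₁ ⊕ ι₂) ⊕ C.deltaLt → A := Sum.elim C.var C.varEll

end WpEllChart

/-! ## Def. 6.10 — admissible charts -/

section Statements

variable {R}
variable {ι₁ : Type u₁} {ι₂ : Type u₂} {ιF : Type u₃} {ιE : Type u₄} {A : Type w} [CommRing A] [Algebra R A]
  [DecidableEq ι₂]

/-- **Definition 6.10 (C47L13–L20; p.106).** «Fix any (kτ)μh ∈ Ω. Consider the inclusion
𝒱̃_{(℘_(kτ)𝔯_μ𝔰_h)} ⊂ ℛ̃_{(℘_(kτ)𝔯_μ𝔰_h)}. An affine chart 𝔙 of ℛ̃_{(℘_(kτ)𝔯_μ𝔰_h)} is called admissible if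
𝔙 ∩ 𝒱̃_{(℘_(kτ)𝔯_μ𝔰_h)} ≠ ∅.» (C47L22–L25: «Thus, 𝒱̃ … can be covered by admissible charts. Again, recall that give
[sic] a blowup morphsim [sic] Y ⟶ X, we say an affine chart 𝔙 of Y lies over an affine chart 𝔙' [of] X if 𝔙 is
mapped into 𝔙'.») Typed on the chart data: the ideal of `𝒱̃ ∩ 𝔙` is proper.
[claim: Hu2025, status: under-review]
STATUS: candidate statement under adjudication (D-0012/D-0089); not asserted. -/
def IsAdmissible (C : WpEllChart ι₁ ι₂ ιF ιE A) : Prop := C.vIdeal ≠ ⊤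

/-- **Definition 6.10 under its printed name** (alias of `IsAdmissible`; C47L13–L20; p.106).
[claim: Hu2025, status: under-review]
STATUS: candidate statement under adjudication (D-0012/D-0089); not asserted. -/
abbrev Def6_10 (C : WpEllChart ι₁ ι₂ ιF ιE A) : Prop := IsAdmissible C

/-! ## Prop. 6.11 — the induction platform on an admissible chart (parts typed one by one) -/

/-- **Prop. 6.11, (◇) «Smoothness of ℛ̃_{(℘_(kτ)𝔯_μ𝔰_h)} along 𝒱̃_{(℘_(kτ)𝔯_μ𝔰_h)}» (C47L61–L65; p.107), chart
clause.** «By shrinking the admissible affine chart 𝔙 if necessary, we have that 𝔙 is smooth.» Typed: the coordinate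
ring of the (shrunk) admissible chart is a smooth `R`-algebra (Mathlib `Algebra.Smooth`: formally smooth of finite
presentation). Frame (induction on `(kτ)μh ∈ Ω`, C47L36–L44) = row 108 file b.
[claim: Hu2025, status: under-review]
STATUS: candidate statement under adjudication (D-0012/D-0089); not asserted. -/
def Prop6_11_smooth (C : WpEllChart ι₁ ι₂ ιF ιE A) : Prop := IsAdmissible C → IsSmoothAlg R A

/-- **Prop. 6.11, (◇) smoothness, centre clause (C47L65–L68; p.107).** «More precisely, 𝔙' ∩ Z'_{φ_(kτ)μh} is smooth,
where Z'_{φ_(kτ)μh} is the proper transform of the ℘- or ℓ-center Z_{φ_(kτ)μh} in ℛ̃_{(℘_(kτ)𝔯_μ𝔰_{h−1})}.» Typed on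
the PARENT chart `𝔙'` (coordinate ring `A'`) with the chart ideal `centre` of `Z'_{φ_(kτ)μh} ∩ 𝔙'` as explicit data:
the quotient is a smooth `R`-algebra.
[claim: Hu2025, status: under-review]
STATUS: candidate statement under adjudication (D-0012/D-0089); not asserted. -/
def Prop6_11_centreSmooth {A' : Type w} [CommRing A'] [Algebra R A'] (C' : WpEllChart ι₁ ι₂ ιF ιE A')
    (centre : Ideal A') : Prop :=
  IsAdmissible C' → IsSmoothAlg R (A' ⧸ centre)

/-- **Prop. 6.11, (◇) «Various exceptional divisors on the chart and their labels» (C47L70–L97; p.107), the LABELLING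
clause.** «… such that every exceptional divisor E (i.e., not a ϖ- nor a ϱ-divisor nor a 𝔏-divisor) of ℛ̃_{℘_(kτ)}
with E ∩ 𝔙 ≠ ∅ is either labeled by a unique element w ∈ 𝔢_𝔙 or labeled by a unique element (u, v) ∈ 𝔡_𝔙 or
labeled by a unique element L ∈ 𝔩_𝔙. We let E_{ℓ_k,w} be the unique exceptional divisor on the chart 𝔙 labeled by
w ∈ 𝔢_𝔙; we call it an ϖ-exceptional divisor. We let E_{ℓ_k,(u,v)} be the unique exceptional divisor on the chart 𝔙
labeled by (u, v) ∈ 𝔡_𝔙; we call it an ϱ-exceptional divisor. We let E_{ℓ_k,L} be the unique exceptional divisor on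
the chart 𝔙 labeled by L ∈ 𝔩_𝔙; we call it an 𝔩-exceptional divisor.» Also the printed inclusion «𝔡^lt_𝔙 ⊂ 𝔡_𝔙»
(C47L81). Typed: (i) `E ∩ 𝔙 ≠ ∅` (chart ideal `≠ ⊤`) iff `E` carries a label; (ii) labels lie in `𝔢_𝔙 ⊔ 𝔡_𝔙 ⊔ 𝔩_𝔙`;
(iii) distinct divisors meeting the chart carry distinct labels and every element of `𝔢_𝔙 ⊔ 𝔡_𝔙 ⊔ 𝔩_𝔙` labels some
divisor («the unique exceptional divisor … labeled by w»); (iv) «𝔡^lt_𝔙 = {(m, u_F) ∣ L_F ∈ 𝔩_𝔙} ⊂ 𝔡_𝔙» read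
element-wise: for every `F` with `L_F ∈ 𝔩_𝔙` the index `(m,u_F)` lies in `Λ⋆_𝔉` (`ltIdx F = some _`) and in `𝔡_𝔙`
(this implies `WpEllChart.deltaLt ⊆ del`; without the `some`-clause an `F ∈ 𝔩_𝔙` with `ltIdx F = none` would make
items (7)/(9) vacuous at `F`).
[claim: Hu2025, status: under-review]
STATUS: candidate statement under adjudication (D-0012/D-0089); not asserted. -/
def Prop6_11_labels (C : WpEllChart ι₁ ι₂ ιF ιE A) : Prop :=
  (∀ E, C.excDiv E ≠ ⊤ ↔ (C.lab E).isSome) ∧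
  (∀ E l, C.lab E = some l →
      Sum.elim (fun w => w ∈ C.eps) (Sum.elim (fun uv => uv ∈ C.del) (fun F => F ∈ C.ell)) l) ∧
  (∀ E₁ E₂ l, C.lab E₁ = some l → C.lab E₂ = some l → E₁ = E₂) ∧
  (∀ l : ι₁ ⊕ ι₂ ⊕ ιF,
      Sum.elim (fun w => w ∈ C.eps) (Sum.elim (fun uv => uv ∈ C.del) (fun F => F ∈ C.ell)) l →
        ∃ E, C.lab E = some l) ∧
  (∀ F ∈ C.ell, ∃ uv, C.ltIdx F = some uv ∧ uv ∈ C.del)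

/-- **Prop. 6.11, (◇) «Various free variables of [sic] on the chart», eq. (6.8) — the CLAIM that `Var_𝔙` is a set
of free variables (C47L101–L118; p.107; proof sentence C50L123–L124 «Substituting (blowup-relation:℘/ℓ), one sees that
Var_𝔙 is a set of free variables on the open chart 𝔙»).** PARAMETRIC in the reading `IsFreeVariables` of «set of free
variables on the open chart» (instantiations: `Prop6_11_var_loc`, `_etale`, `_indep`).
[claim: Hu2025, status: under-review]
STATUS: candidate statement under adjudication (D-0012/D-0089); not asserted. -/
def Prop6_11_var (IsFreeVariables : (ι₁ ⊕ ι₂ → A) → Prop) (C : WpEllChart ι₁ ι₂ ιF ιE A) : Prop :=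
  IsAdmissible C → IsFreeVariables C.var

/-- **The proof sentence for eq. (6.8)** (C50L123–L124; p.114): «Substituting (blowup-relation:℘/ℓ), one sees that
Var_𝔙 is a set of free variables on the open chart 𝔙.» Alias of `Prop6_11_var` (anchor name by chunk + line).
[claim: Hu2025, status: under-review]
STATUS: candidate statement under adjudication (D-0012/D-0089); not asserted. -/
abbrev C50L123 (IsFreeVariables : (ι₁ ⊕ ι₂ → A) → Prop) (C : WpEllChart ι₁ ι₂ ιF ιE A) : Prop :=
  Prop6_11_var IsFreeVariables C

/-- `Prop6_11_var` at the LOCALIZATION reading `IsFreeVariablesLoc` (OURS instantiation).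
[claim: Hu2025, status: under-review]
STATUS: candidate statement under adjudication (D-0012/D-0089); not asserted. -/
def Prop6_11_var_loc (C : WpEllChart ι₁ ι₂ ιF ιE A) : Prop := Prop6_11_var (IsFreeVariablesLoc R) C

/-- `Prop6_11_var` at the ÉTALE reading `IsFreeVariablesEtale` (OURS instantiation).
[claim: Hu2025, status: under-review]
STATUS: candidate statement under adjudication (D-0012/D-0089); not asserted. -/
def Prop6_11_var_etale (C : WpEllChart ι₁ ι₂ ιF ιE A) : Prop := Prop6_11_var (IsFreeVariablesEtale R) C

/-- `Prop6_11_var` at the ALGEBRAIC-INDEPENDENCE reading `IsFreeVariablesIndep` (OURS instantiation).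
[claim: Hu2025, status: under-review]
STATUS: candidate statement under adjudication (D-0012/D-0089); not asserted. -/
def Prop6_11_var_indep (C : WpEllChart ι₁ ι₂ ιF ιE A) : Prop := Prop6_11_var (IsFreeVariablesIndep R) C

/-- **Prop. 6.11, (◇) variables, the INVERTIBILITY clause (C47L126; p.108; restated in (9)).** «such that,
y_{𝔙,(m,u_F)} ∈ Var_𝔙, (m, u_F) ∈ 𝔡^lt_𝔙, are invertible on the chart, which will be restated in (9) below and be
prove [sic] accordingly». Typed: for every `(m,u_F) ∈ 𝔡^lt_𝔙` the `Var_𝔙`-variable of that index is a unit of `A`.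
[claim: Hu2025, status: under-review]
STATUS: candidate statement under adjudication (D-0012/D-0089); not asserted. -/
def Prop6_11_yUnit (C : WpEllChart ι₁ ι₂ ιF ιE A) : Prop :=
  IsAdmissible C → ∀ uv ∈ C.deltaLt, IsUnit (C.var₂ uv)

/-- **Prop. 6.11, eq. (6.9) = JOINT J4 / G-H11 of lit/PARTITION-HU.md §4 (statement C47L135–L141; p.108; proof
sentence C50L135–L137).** «Furthermore, we also have a set of free variables
Var^∨_𝔙 = ({y ∈ Var_𝔙} ∖ {y_{(m,u_F)} ∣ L_F ∈ 𝔩_𝔙}) ⊔ {δ_{𝔙,(m,u_F)} ∣ L_F ∈ 𝔩_𝔙}.» PARAMETRIC in the reading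
`IsFreeVariables` of «set of free variables on the open chart» (instantiations `_loc`, `_etale`, `_indep`); the
family is `WpEllChart.varVee`. Index (never a premise): pub-hironaka/HU-GAP.md §4; tree `Hu2025/EllRestriction.lean`.
[claim: Hu2025, status: under-review]
STATUS: candidate statement under adjudication (D-0012/D-0089); not asserted. -/
def Prop6_11_varVee (IsFreeVariables : (ι₁ ⊕ ι₂ → A) → Prop) (C : WpEllChart ι₁ ι₂ ιF ιE A) : Prop :=
  IsAdmissible C → IsFreeVariables C.varVee

/-- **The proof sentence for eq. (6.9)** (C50L135–L137; p.114): «One sees that Var^∨_𝔙 is also a set of free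
variables on the open chart 𝔙. This checks (variables-wp/ell-vee) in the proposition.» Alias of `Prop6_11_varVee`
(anchor name by chunk + line; PARTITION-HU §4 J4).
[claim: Hu2025, status: under-review]
STATUS: candidate statement under adjudication (D-0012/D-0089); not asserted. -/
abbrev C50L135 (IsFreeVariables : (ι₁ ⊕ ι₂ → A) → Prop) (C : WpEllChart ι₁ ι₂ ιF ιE A) : Prop :=
  Prop6_11_varVee IsFreeVariables C

/-- `Prop6_11_varVee` at the LOCALIZATION reading `IsFreeVariablesLoc` (OURS instantiation).
[claim: Hu2025, status: under-review]
STATUS: candidate statement under adjudication (D-0012/D-0089); not asserted. -/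
def Prop6_11_varVee_loc (C : WpEllChart ι₁ ι₂ ιF ιE A) : Prop := Prop6_11_varVee (IsFreeVariablesLoc R) C

/-- `Prop6_11_varVee` at the ÉTALE reading `IsFreeVariablesEtale` (OURS instantiation).
[claim: Hu2025, status: under-review]
STATUS: candidate statement under adjudication (D-0012/D-0089); not asserted. -/
def Prop6_11_varVee_etale (C : WpEllChart ι₁ ι₂ ιF ιE A) : Prop := Prop6_11_varVee (IsFreeVariablesEtale R) C

/-- `Prop6_11_varVee` at the ALGEBRAIC-INDEPENDENCE reading `IsFreeVariablesIndep` (OURS instantiation).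
[claim: Hu2025, status: under-review]
STATUS: candidate statement under adjudication (D-0012/D-0089); not asserted. -/
def Prop6_11_varVee_indep (C : WpEllChart ι₁ ι₂ ιF ιE A) : Prop := Prop6_11_varVee (IsFreeVariablesIndep R) C

/-- **Prop. 6.11, the clause on the relations (C47L143–L148; p.108; proof sentence C50L139–L142).** «We set
Var^+_𝔙 = Var_𝔙 ⊔ Var_{𝔩_𝔙}. Then, all the relations in ℬ^gov_𝔙, ℬ^frb_𝔙, {L_{𝔙,F} ∣ F ∈ 𝔉} are polynomials in
Var^+_𝔙.» Typed with the chart's relation families as explicit data `govRel`, `frbRel` (the proper transforms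
`B_𝔙`, `B ∈ ℬ^gov ∪ ℬ^frb`, §6.4 C53L12–L18; rows 103–105 index them) and `C.ellForm`: each lies in the image of the
evaluation map `R[Var^+_𝔙] → A`.
[claim: Hu2025, status: under-review]
STATUS: candidate statement under adjudication (D-0012/D-0089); not asserted. -/
def Prop6_11_relPoly {ιB ιB' : Type*} (govRel : ιB → A) (frbRel : ιB' → A)
    (C : WpEllChart ι₁ ι₂ ιF ιE A) : Prop :=
  IsAdmissible C →
    (∀ b, govRel b ∈ (MvPolynomial.aeval (R := R) C.varPlus).range) ∧
    (∀ b, frbRel b ∈ (MvPolynomial.aeval (R := R) C.varPlus).range) ∧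
    (∀ F, C.ellForm F ∈ (MvPolynomial.aeval (R := R) C.varPlus).range)

/-- Anchor alias of `Prop6_11_relPoly` by chunk + line (C47L147–L148 «Then, all the relations in ℬ^gov_𝔙, ℬ^frb_𝔙,
{L_{𝔙,F} ∣ F ∈ 𝔉} are polynomials in Var^+_𝔙»).
[claim: Hu2025, status: under-review]
STATUS: candidate statement under adjudication (D-0012/D-0089); not asserted. -/
abbrev C47L147 {ιB ιB' : Type*} (govRel : ιB → A) (frbRel : ιB' → A) (C : WpEllChart ι₁ ι₂ ιF ιE A) : Prop :=
  Prop6_11_relPoly (R := R) govRel frbRel C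

end Statements

/-! ## Name concordance with lit/PARTITION-HU.md row 108 «expected decls» (aliases; same content) -/

section Concordance

variable {ι₁ : Type u₁} {ι₂ : Type u₂} {ιF : Type u₃} {ιE : Type u₄} {A : Type w} [CommRing A]

/-- **Definition 6.10 under PARTITION-HU row 108's expected name `IsAdmissibleChart`** (alias of `IsAdmissible`;
C47L13–L20; p.106): «An affine chart 𝔙 of ℛ̃_{(℘_(kτ)𝔯_μ𝔰_h)} is called admissible if 𝔙 ∩ 𝒱̃_{(℘_(kτ)𝔯_μ𝔰_h)} ≠ ∅.»
[claim: Hu2025, status: under-review]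
STATUS: candidate statement under adjudication (D-0012/D-0089); not asserted. -/
abbrev IsAdmissibleChart (C : WpEllChart ι₁ ι₂ ιF ιE A) : Prop := IsAdmissible C

/-- **The carrier `𝔩_𝔙 ⊂ L_{𝔉,[k]}` of Prop. 6.11 under PARTITION-HU row 108's expected name `Prop6_11_lV`** (alias of
`WpEllChart.ellSet` = the field `ell`; C47L77; p.107: «and a subset 𝔩_𝔙 ⊂ L_{𝔉,[k]}»). Read by JOINT J4 (§7.2).
[claim: Hu2025, status: under-review]
STATUS: candidate statement under adjudication (D-0012/D-0089); not asserted. -/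
abbrev Prop6_11_lV (C : WpEllChart ι₁ ι₂ ιF ιE A) : Finset ιF := C.ellSet

variable [DecidableEq ι₂]

/-- **The carrier `𝔡^lt_𝔙 = {(m, u_F) ∣ L_F ∈ 𝔩_𝔙} ⊂ 𝔡_𝔙` of Prop. 6.11 under PARTITION-HU row 108's expected name
`Prop6_11_dV`** (alias of `WpEllChart.deltaLt`; C47L81; p.107: «the subset 𝔡^lt_𝔙 = {(m, u_F) ∣ L_F ∈ 𝔩_𝔙} ⊂ 𝔡_𝔙»; the
inclusion itself is conjunct (iv) of `Prop6_11_labels`). Read by JOINT J4 (§7.2).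
[claim: Hu2025, status: under-review]
STATUS: candidate statement under adjudication (D-0012/D-0089); not asserted. -/
abbrev Prop6_11_dV (C : WpEllChart ι₁ ι₂ ιF ιE A) : Finset ι₂ := C.deltaLt

end Concordance

end Literature.AlgebraicGeometry.Hu2025.Statements.S06WpEllBlowups

end
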